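import Literature.NumberTheory.Sieve.GoldstonPintzYildirimLemma3Outer
import HarnessLib

/-!
# Goldston–Pintz–Yıldırım, Lemma 3 — the diagonal term `I₃`

Trunk: NumberTheory / Sieve, continuing `GoldstonPintzYildirimLemma3Outer` (GPY, *Primes in
tuples I*, §8, (8.20)–(8.24)). The diagonal residue term `r(s₂)` (from the pole `s₁ = −s₂`) is
integrated over the line `Re s₂ = θ`, `|Im s₂| ≤ T`. Near `s₂ = 0` the segment `|Im s₂| ≤ η₀` is
replaced by the three other sides of the rectangle `[θ, η₀] × [−η₀, η₀]` (Cauchy–Goursat: `r` is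
holomorphic there, `differentiableOn_diagRes`), on which `|s₂| ≥ η₀`; away from `0` the bound
`|r(s₂)| ≪ B η (3/2η)^d (C log(|t|+4))^{a+b} R^η / |s₂|^{u+v+a+b+2}` of `norm_diagRes_le` is
integrated (`∫_{η₀}^{∞} dt/t^{n} ≤ 1/((n−1) η₀^{n−1})`). With `η ≍ 1/log R`, `η₀ = 1/log log R`
the whole diagonal contribution is `≪ B (log R)^{d−1} (log log R)^{O(1)}` — GPY's (8.23) "I₃ ≪
(log N)^{d−1}… " up to the powers of `log log` this explicit form carries. Everything here is
PROVED:

* `diagRes_bump_identity` — `I ∫_{−η₀}^{η₀} r(θ+it) dt = ∫_θ^{X} r(x − iη₀)dx − ∫_θ^{X} r(x + iη₀)dx + I ∫_{−η₀}^{η₀} r(X+it)dt`;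
* `norm_diagRes_le_unif` — a `t`-uniform form of the pointwise bound:
  `|r(s₂)| ≤ K_r (|s₂|^{−q} + |s₂|^{−(u+v+2)})`, `q = u+v+a+b+2`,
  `K_r = 8η B (3/2η)^d (5C₁)^{a+b} R^η 2^{u+1+a}`, `C₁ = max C 1`;
* `norm_integral_diagRes_far_le` — `‖∫_{η₀ ≤ ±t ≤ T} r(θ+it) dt‖ ≤ 2 K_r / η₀^{q−1}` each;
* `norm_diagRes_bump_le` — the three bump sides contribute `≤ 8 K_r / η₀^{q−1}` (`X = η₀`).

## References

* D. A. Goldston, J. Pintz, C. Y. Yıldırım, *Primes in tuples. I*, Ann. of Math. (2) 170 (2009),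
  819–862 = arXiv:math/0508185, §8 (8.20)–(8.24). [cite: GoldstonPintzYildirim2009]
-/

noncomputable section

open Complex Filter Topology MeasureTheory Set intervalIntegral
open scoped Real Interval

namespace Literature.NumberTheory.Sieve.GPY

open Literature.Analysis.Complex (rectBoundaryIntegral)
open Literature.NumberTheory.LFunctions.Nicolas (zetaOne zetaOne_zero differentiable_zetaOne zetaOne_of_ne_zero)

section Diag

variable {G : ℂ → ℂ → ℂ} {cbar C : ℝ}

/-! ### The bump -/

/-- **The bump identity** (Cauchy–Goursat for `r` on `[θ, X] × [−η₀, η₀]`): with `4η ≤ θ < X < Y`,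
`0 < η₀ < Y′`, `η + Y < 1/4`, `η + Y ≤ 4c̄/log(η + Y′ + 3)`,
`I ∫_{−η₀}^{η₀} r(θ+it) dt = ∫_θ^{X} r(x − iη₀) dx − ∫_θ^{X} r(x + iη₀) dx + I ∫_{−η₀}^{η₀} r(X+it) dt`.
[cite: GoldstonPintzYildirim2009, Section 8 eq. 8.21] -/
theorem diagRes_bump_identity
    (hWz : ∀ z : ℂ, z ≠ 0 → -(4 * cbar / Real.log (|z.im| + 3)) ≤ z.re → zetaOne z ≠ 0)
    (hc : 0 ≤ cbar) (hG : DifferentiableOn ℂ (fun z : ℂ × ℂ => G z.1 z.2) G₂Region)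
    {R : ℝ} (hR : 0 < R) (a b d u v : ℕ) {η θ X Y Y' η₀ : ℝ} (hη : 0 < η) (hθ : 4 * η ≤ θ)
    (hθX : θ ≤ X) (hXY : X < Y) (hη₀ : 0 < η₀) (hη₀Y : η₀ < Y') (hquarter : η + Y < 1 / 4)
    (hzfr : η + Y ≤ 4 * cbar / Real.log (η + Y' + 3)) :
    I * (∫ t : ℝ in (-η₀)..η₀, diagRes G R a b d u v η ((θ : ℂ) + t * I)) =
      (∫ x : ℝ in θ..X, diagRes G R a b d u v η ((x : ℂ) + ((-η₀ : ℝ) : ℂ) * I)) -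
        (∫ x : ℝ in θ..X, diagRes G R a b d u v η ((x : ℂ) + (η₀ : ℂ) * I)) +
        I * ∫ t : ℝ in (-η₀)..η₀, diagRes G R a b d u v η ((X : ℂ) + t * I) := by
  have hdiff := differentiableOn_diagRes hWz hc hG hR a b d u v (η := η) (θlo := θ / 2) (Y := Y)
    (Y' := Y') hη (by linarith) hquarter hzfr
  have hsub : (Icc θ X ×ℂ Icc (-η₀) η₀) ⊆ {s₂ : ℂ | θ / 2 < s₂.re ∧ s₂.re < Y ∧ |s₂.im| < Y'} := by
    rintro s₂ ⟨hre, him⟩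
    refine ⟨by linarith [hre.1], by linarith [hre.2], abs_lt.2 ⟨by linarith [him.1], by linarith [him.2]⟩⟩
  have h0 := Literature.Analysis.Complex.rectBoundaryIntegral_eq_zero_of_differentiableOn
    (F := diagRes G R a b d u v η) hθX (by linarith : -η₀ ≤ η₀) (hdiff.mono hsub)
  rw [Literature.Analysis.Complex.rectBoundaryIntegral] at h0
  linear_combination (-1 : ℂ) * h0

/-! ### A `t`-uniform pointwise bound for `r` -/

/-- The uniform constant `K_r = 8η B (3/(2η))^d (5 C₁)^{a+b} R^η 2^{u+1+a}`, `C₁ = max C 1`.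
[cite: GoldstonPintzYildirim2009, Section 8 eq. 8.24] -/
def diagConst (B C R η : ℝ) (a b d u : ℕ) : ℝ :=
  8 * η * (B * (3 / (2 * η)) ^ d * (5 * max C 1) ^ (a + b) * R ^ η * 2 ^ (u + 1 + a))

/-- `K_r ≥ 0`. [folklore] -/
theorem diagConst_nonneg {B C R η : ℝ} (hB : 0 ≤ B) (hR : 0 ≤ R) (hη : 0 ≤ η) (a b d u : ℕ) :
    0 ≤ diagConst B C R η a b d u := by
  unfold diagConst
  have : 0 ≤ max C 1 := le_max_of_le_right zero_le_one
  positivity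

/-- `log(x + 3) ≤ x + 4`... precisely `log(y) ≤ y` for `y > 0`, used as `log(|t|+η+3) ≤ |t| + 4`
(`η ≤ 1`). [folklore] -/
theorem log_height_le {t η : ℝ} (hη0 : 0 ≤ η) (hη : η ≤ 1) : Real.log (|t| + η + 3) ≤ |t| + 4 := by
  have h := Real.log_le_sub_one_of_pos (by linarith [abs_nonneg t] : 0 < |t| + η + 3)
  linarith

/-- **Uniform pointwise bound**: under the hypotheses of `norm_diagRes_le` (and `η ≤ 1`, `C ≥ 0`),
`|r(s₂)| ≤ K_r (|s₂|^{−q} + |s₂|^{−(u+v+2)})`, `q = (u+1+a)+(v+1+b)`: the factor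
`(C log(|Im s₂|+η+3))^{a+b} ≤ (5C₁)^{a+b} max(1, |s₂|)^{a+b}` is absorbed either by the constant
(`|s₂| ≤ 1`) or by `a+b` powers of `|s₂|` (`|s₂| ≥ 1`). [cite: GoldstonPintzYildirim2009, Section 8 eq. 8.24] -/
theorem norm_diagRes_le_unif
    (hWz : ∀ z : ℂ, z ≠ 0 → -(4 * cbar / Real.log (|z.im| + 3)) ≤ z.re →
      zetaOne z ≠ 0 ∧ ‖(zetaOne z)⁻¹‖ ≤ C * Real.log (|z.im| + 3) / ‖z‖ ∧
        ‖zetaOne z‖ ≤ 1 + C * ‖z‖ * Real.log (|z.im| + 3))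
    (hc : 0 ≤ cbar) (hC : 0 ≤ C) {B κ ρW : ℝ} (hB0 : 0 ≤ B)
    (hGB : ∀ s₁ s₂ : ℂ, -κ ≤ s₁.re → s₁.re ≤ 2 → -κ ≤ s₂.re → s₂.re ≤ 2 → ‖G s₁ s₂‖ ≤ B)
    (hρ : ∀ s : ℂ, ‖s‖ ≤ ρW → 1 / 2 ≤ ‖zetaOne s‖ ∧ ‖zetaOne s‖ ≤ 3 / 2)
    {R : ℝ} (hR : 1 ≤ R) (a b d u v : ℕ) {η : ℝ} {s₂ : ℂ} (hη : 0 < η) (hη1 : η ≤ 1) (hηρ : 2 * η ≤ ρW)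
    (hs₂ : 4 * η ≤ s₂.re) (hκ : η + s₂.re ≤ κ) (hquarter : η + s₂.re < 1 / 4)
    (hzfr : η + s₂.re ≤ 4 * cbar / Real.log (|s₂.im| + η + 3)) :
    ‖diagRes G R a b d u v η s₂‖ ≤
      diagConst B C R η a b d u *
        ((‖s₂‖ ^ ((u + 1 + a) + (v + 1 + b)))⁻¹ + (‖s₂‖ ^ (u + v + 2))⁻¹) := by
  have h := norm_diagRes_le hWz hc hC hB0 hGB hρ hR a b d u v hη hηρ hs₂ hκ hquarter hzfr
  refine h.trans ?_
  have hs0 : 0 < ‖s₂‖ := by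
    have : 0 < s₂.re := by linarith
    exact norm_pos_iff.2 (fun h => by rw [h] at this; simp at this)
  set C₁ : ℝ := max C 1 with hC₁
  have hC₁1 : 1 ≤ C₁ := le_max_right _ _
  have hCC₁ : C ≤ C₁ := le_max_left _ _
  have hlog0 : 0 < Real.log (|s₂.im| + η + 3) := Real.log_pos (by linarith [abs_nonneg s₂.im])
  have hlog : Real.log (|s₂.im| + η + 3) ≤ |s₂.im| + 4 := log_height_le hη.le hη1
  have him : |s₂.im| ≤ ‖s₂‖ := Complex.abs_im_le_norm s₂
  -- the log factor against powers of `‖s₂‖`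
  set ℓ : ℝ := C * Real.log (|s₂.im| + η + 3) with hℓdef
  have hℓ0 : 0 ≤ ℓ := by rw [hℓdef]; positivity
  have hℓ : ℓ ≤ C₁ * (‖s₂‖ + 4) := by
    calc ℓ ≤ C₁ * Real.log (|s₂.im| + η + 3) := mul_le_mul_of_nonneg_right hCC₁ hlog0.le
      _ ≤ C₁ * (|s₂.im| + 4) := mul_le_mul_of_nonneg_left hlog (by linarith)
      _ ≤ C₁ * (‖s₂‖ + 4) := by gcongr
  have hn1 : 0 < ‖s₂‖ ^ (u + 1 + a) := by positivity
  have hn2 : 0 < ‖s₂‖ ^ (v + 1 + b) := by positivity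
  have hkey : ℓ ^ a * ℓ ^ b * ((‖s₂‖ ^ (u + 1 + a))⁻¹ * (‖s₂‖ ^ (v + 1 + b))⁻¹) ≤
      (5 * C₁) ^ (a + b) * ((‖s₂‖ ^ ((u + 1 + a) + (v + 1 + b)))⁻¹ + (‖s₂‖ ^ (u + v + 2))⁻¹) := by
    rcases le_or_gt ‖s₂‖ 1 with hn | hn
    · have h5 : ℓ ≤ 5 * C₁ := hℓ.trans (by nlinarith)
      have ha := pow_le_pow_left₀ hℓ0 h5 a
      have hb := pow_le_pow_left₀ hℓ0 h5 b
      calc ℓ ^ a * ℓ ^ b * ((‖s₂‖ ^ (u + 1 + a))⁻¹ * (‖s₂‖ ^ (v + 1 + b))⁻¹)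
          ≤ (5 * C₁) ^ a * (5 * C₁) ^ b * ((‖s₂‖ ^ (u + 1 + a))⁻¹ * (‖s₂‖ ^ (v + 1 + b))⁻¹) := by
            gcongr
        _ = (5 * C₁) ^ (a + b) * (‖s₂‖ ^ ((u + 1 + a) + (v + 1 + b)))⁻¹ := by
            rw [pow_add (5 * C₁), pow_add ‖s₂‖ (u + 1 + a), mul_inv]
        _ ≤ _ := by
            have : 0 ≤ (‖s₂‖ ^ (u + v + 2))⁻¹ := by positivity
            have h0 : 0 ≤ (5 * C₁) ^ (a + b) := by positivity
            nlinarith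
    · have h5 : ℓ ≤ 5 * C₁ * ‖s₂‖ := hℓ.trans (by nlinarith)
      have ha := pow_le_pow_left₀ hℓ0 h5 a
      have hb := pow_le_pow_left₀ hℓ0 h5 b
      calc ℓ ^ a * ℓ ^ b * ((‖s₂‖ ^ (u + 1 + a))⁻¹ * (‖s₂‖ ^ (v + 1 + b))⁻¹)
          ≤ (5 * C₁ * ‖s₂‖) ^ a * (5 * C₁ * ‖s₂‖) ^ b *
              ((‖s₂‖ ^ (u + 1 + a))⁻¹ * (‖s₂‖ ^ (v + 1 + b))⁻¹) := by gcongr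
        _ = (5 * C₁) ^ (a + b) * (‖s₂‖ ^ (u + v + 2))⁻¹ := by
            have hs0' : ‖s₂‖ ≠ 0 := hs0.ne'
            rw [mul_pow, mul_pow, pow_add (5 * C₁)]
            field_simp
            ring
        _ ≤ _ := by
            have : 0 ≤ (‖s₂‖ ^ ((u + 1 + a) + (v + 1 + b)))⁻¹ := by positivity
            have h0 : 0 ≤ (5 * C₁) ^ (a + b) := by positivity
            nlinarith
  have hrest : 0 ≤ 8 * η * (B * (3 / (2 * η)) ^ d * R ^ η * 2 ^ (u + 1 + a)) := by positivity
  calc 8 * η * (B * (3 / (2 * η)) ^ d * (C * Real.log (|s₂.im| + η + 3)) ^ a *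
        (C * Real.log (|s₂.im| + η + 3)) ^ b * R ^ η * 2 ^ (u + 1 + a) *
        ((‖s₂‖ ^ (u + 1 + a))⁻¹ * (‖s₂‖ ^ (v + 1 + b))⁻¹))
      = 8 * η * (B * (3 / (2 * η)) ^ d * R ^ η * 2 ^ (u + 1 + a)) *
        (ℓ ^ a * ℓ ^ b * ((‖s₂‖ ^ (u + 1 + a))⁻¹ * (‖s₂‖ ^ (v + 1 + b))⁻¹)) := by
        rw [hℓdef]; ring
    _ ≤ 8 * η * (B * (3 / (2 * η)) ^ d * R ^ η * 2 ^ (u + 1 + a)) *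
        ((5 * C₁) ^ (a + b) * ((‖s₂‖ ^ ((u + 1 + a) + (v + 1 + b)))⁻¹ + (‖s₂‖ ^ (u + v + 2))⁻¹)) :=
        mul_le_mul_of_nonneg_left hkey hrest
    _ = _ := by rw [diagConst, hC₁]; ring

/-! ### Integrating the uniform bound away from `0` -/

/-- `∫_{η₀}^{T} (t^{-(k+1)}) dt ≤ 1/(k η₀^k)` for `0 < η₀ ≤ T`, `k ≥ 1`. [folklore] -/
theorem intervalIntegral_inv_pow_le {η₀ T : ℝ} (hη₀ : 0 < η₀) (hT : η₀ ≤ T) {k : ℕ} (hk : 1 ≤ k) :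
    ∫ t : ℝ in η₀..T, (t ^ (k + 1))⁻¹ ≤ 1 / (k * η₀ ^ k) := by
  obtain ⟨hint, hval⟩ := Literature.Analysis.Complex.integral_Ioi_inv_pow_le hη₀ hk
  refine le_trans ?_ hval
  rw [intervalIntegral.integral_of_le hT]
  have hf : 0 ≤ᵐ[volume.restrict (Ioi η₀)] (fun t : ℝ => (t ^ (k + 1))⁻¹) := by
    filter_upwards [self_mem_ae_restrict (measurableSet_Ioi : MeasurableSet (Ioi η₀))] with t ht
    have : 0 < t := hη₀.trans ht
    positivity
  exact setIntegral_mono_set hint hf (ae_of_all _ (fun t ht => Set.Ioc_subset_Ioi_self ht))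

/-- **A real-variable lemma**: if `‖g t‖ ≤ K ((|t|^{q})⁻¹ + (|t|^{n})⁻¹)` for `η₀ ≤ |t| ≤ T`
(`0 < η₀ ≤ T`, `2 ≤ n`, `2 ≤ q`, `K ≥ 0`), then
`‖∫_{η₀}^{T} g‖, ‖∫_{−T}^{−η₀} g‖ ≤ K (1/((q−1) η₀^{q−1}) + 1/((n−1) η₀^{n−1}))`. [folklore] -/
theorem norm_integral_far_le {g : ℝ → ℂ} {K η₀ T : ℝ} {q n : ℕ} (hK : 0 ≤ K) (hη₀ : 0 < η₀)
    (hT : η₀ ≤ T) (hq : 2 ≤ q) (hn : 2 ≤ n)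
    (hg : ∀ t : ℝ, η₀ ≤ |t| → |t| ≤ T → ‖g t‖ ≤ K * ((|t| ^ q)⁻¹ + (|t| ^ n)⁻¹)) :
    ‖∫ t : ℝ in η₀..T, g t‖ ≤ K * (1 / ((q - 1 : ℕ) * η₀ ^ (q - 1)) + 1 / ((n - 1 : ℕ) * η₀ ^ (n - 1))) ∧
    ‖∫ t : ℝ in (-T)..(-η₀), g t‖ ≤ K * (1 / ((q - 1 : ℕ) * η₀ ^ (q - 1)) + 1 / ((n - 1 : ℕ) * η₀ ^ (n - 1))) := by
  obtain ⟨q', rfl⟩ : ∃ q', q = q' + 1 := ⟨q - 1, by omega⟩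
  obtain ⟨n', rfl⟩ : ∃ n', n = n' + 1 := ⟨n - 1, by omega⟩
  simp only [Nat.add_sub_cancel]
  have hq' : 1 ≤ q' := by omega
  have hn' : 1 ≤ n' := by omega
  -- the majorant and its integral
  have hmaj_cont : ContinuousOn (fun t : ℝ => K * ((t ^ (q' + 1))⁻¹ + (t ^ (n' + 1))⁻¹)) (Icc η₀ T) := by
    refine continuousOn_const.mul ((ContinuousOn.inv₀ (continuousOn_pow _) fun t ht => ?_).add
      (ContinuousOn.inv₀ (continuousOn_pow _) fun t ht => ?_)) <;>
    exact pow_ne_zero _ (by linarith [ht.1] : t ≠ 0)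
  have hmaj_int : IntervalIntegrable (fun t : ℝ => K * ((t ^ (q' + 1))⁻¹ + (t ^ (n' + 1))⁻¹)) volume η₀ T :=
    (hmaj_cont.mono (by rw [uIcc_of_le hT])).intervalIntegrable
  have hmaj_val : ∫ t : ℝ in η₀..T, K * ((t ^ (q' + 1))⁻¹ + (t ^ (n' + 1))⁻¹) ≤
      K * (1 / (q' * η₀ ^ q') + 1 / (n' * η₀ ^ n')) := by
    rw [intervalIntegral.integral_const_mul]
    refine mul_le_mul_of_nonneg_left ?_ hK
    have hi1 : IntervalIntegrable (fun t : ℝ => (t ^ (q' + 1))⁻¹) volume η₀ T := by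
      refine ContinuousOn.intervalIntegrable ?_
      rw [uIcc_of_le hT]
      exact ContinuousOn.inv₀ (continuousOn_pow _) fun t ht => pow_ne_zero _ (by linarith [ht.1])
    have hi2 : IntervalIntegrable (fun t : ℝ => (t ^ (n' + 1))⁻¹) volume η₀ T := by
      refine ContinuousOn.intervalIntegrable ?_
      rw [uIcc_of_le hT]
      exact ContinuousOn.inv₀ (continuousOn_pow _) fun t ht => pow_ne_zero _ (by linarith [ht.1])
    rw [intervalIntegral.integral_add hi1 hi2]
    exact add_le_add (intervalIntegral_inv_pow_le hη₀ hT hq') (intervalIntegral_inv_pow_le hη₀ hT hn')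
  constructor
  · calc ‖∫ t : ℝ in η₀..T, g t‖ ≤ ∫ t : ℝ in η₀..T, K * ((t ^ (q' + 1))⁻¹ + (t ^ (n' + 1))⁻¹) := by
          refine intervalIntegral.norm_integral_le_of_norm_le hT (Eventually.of_forall fun t ht => ?_) hmaj_int
          have ht0 : 0 < t := by linarith [ht.1]
          have h := hg t (by rw [abs_of_pos ht0]; exact ht.1.le) (by rw [abs_of_pos ht0]; exact ht.2)
          rwa [abs_of_pos ht0] at h
      _ ≤ _ := hmaj_val
  · rw [show (∫ t : ℝ in (-T)..(-η₀), g t) = ∫ t : ℝ in η₀..T, g (-t) by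
      rw [intervalIntegral.integral_comp_neg] ]
    calc ‖∫ t : ℝ in η₀..T, g (-t)‖ ≤ ∫ t : ℝ in η₀..T, K * ((t ^ (q' + 1))⁻¹ + (t ^ (n' + 1))⁻¹) := by
          refine intervalIntegral.norm_integral_le_of_norm_le hT (Eventually.of_forall fun t ht => ?_) hmaj_int
          have ht0 : 0 < t := by linarith [ht.1]
          have h := hg (-t) (by rw [abs_neg, abs_of_pos ht0]; exact ht.1.le)
            (by rw [abs_neg, abs_of_pos ht0]; exact ht.2)
          rwa [abs_neg, abs_of_pos ht0] at h
      _ ≤ _ := hmaj_val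

/-- **The diagonal term away from `0`**: on `Re s₂ = θ` (`4η ≤ θ`), for `η₀ ≤ |t| ≤ T`
(`0 < η₀ ≤ T`), with `η ≤ 1`, `η + θ ≤ κ`, `η + θ < 1/4`, `η + θ ≤ 4c̄/log(T + η + 3)`, `a+u ≥ 1`... (only
`u + v + 2 ≥ 2` is used):
`‖∫_{η₀}^{T} r(θ+it)dt‖, ‖∫_{−T}^{−η₀} r(θ+it)dt‖ ≤ K_r (1/((q−1)η₀^{q−1}) + 1/((u+v+1)η₀^{u+v+1}))`,
`q = u+v+a+b+2`. [cite: GoldstonPintzYildirim2009, Section 8 eq. 8.23] -/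
theorem norm_integral_diagRes_far_le
    (hWz : ∀ z : ℂ, z ≠ 0 → -(4 * cbar / Real.log (|z.im| + 3)) ≤ z.re →
      zetaOne z ≠ 0 ∧ ‖(zetaOne z)⁻¹‖ ≤ C * Real.log (|z.im| + 3) / ‖z‖ ∧
        ‖zetaOne z‖ ≤ 1 + C * ‖z‖ * Real.log (|z.im| + 3))
    (hc : 0 ≤ cbar) (hC : 0 ≤ C) {B κ ρW : ℝ} (hB0 : 0 ≤ B)
    (hGB : ∀ s₁ s₂ : ℂ, -κ ≤ s₁.re → s₁.re ≤ 2 → -κ ≤ s₂.re → s₂.re ≤ 2 → ‖G s₁ s₂‖ ≤ B)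
    (hρ : ∀ s : ℂ, ‖s‖ ≤ ρW → 1 / 2 ≤ ‖zetaOne s‖ ∧ ‖zetaOne s‖ ≤ 3 / 2)
    {R : ℝ} (hR : 1 ≤ R) (a b d u v : ℕ) {η θ η₀ T : ℝ} (hη : 0 < η) (hη1 : η ≤ 1) (hηρ : 2 * η ≤ ρW)
    (hθ : 4 * η ≤ θ) (hκ : η + θ ≤ κ) (hquarter : η + θ < 1 / 4) (hη₀ : 0 < η₀) (hη₀T : η₀ ≤ T)
    (hzfr : η + θ ≤ 4 * cbar / Real.log (T + η + 3)) :
    ‖∫ t : ℝ in η₀..T, diagRes G R a b d u v η ((θ : ℂ) + t * I)‖ ≤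
      diagConst B C R η a b d u * (1 / ((u + v + a + b + 1 : ℕ) * η₀ ^ (u + v + a + b + 1)) +
        1 / ((u + v + 1 : ℕ) * η₀ ^ (u + v + 1))) ∧
    ‖∫ t : ℝ in (-T)..(-η₀), diagRes G R a b d u v η ((θ : ℂ) + t * I)‖ ≤
      diagConst B C R η a b d u * (1 / ((u + v + a + b + 1 : ℕ) * η₀ ^ (u + v + a + b + 1)) +
        1 / ((u + v + 1 : ℕ) * η₀ ^ (u + v + 1))) := by
  have hK := diagConst_nonneg hB0 (by linarith : (0:ℝ) ≤ R) hη.le a b d u (C := C)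
  have h := norm_integral_far_le (g := fun t : ℝ => diagRes G R a b d u v η ((θ : ℂ) + t * I))
    (q := (u + 1 + a) + (v + 1 + b)) (n := u + v + 2) hK hη₀ hη₀T (by omega) (by omega) ?_
  · have e1 : (u + 1 + a) + (v + 1 + b) - 1 = u + v + a + b + 1 := by omega
    have e2 : u + v + 2 - 1 = u + v + 1 := by omega
    rw [e1, e2] at h
    exact h
  · intro t ht htT
    set s₂ : ℂ := (θ : ℂ) + t * I with hs₂
    have hre : s₂.re = θ := by simp [hs₂]
    have him : s₂.im = t := by simp [hs₂]
    have hpt := norm_diagRes_le_unif hWz hc hC hB0 hGB hρ hR a b d u v (s₂ := s₂) hη hη1 hηρ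
      (by rw [hre]; exact hθ) (by rw [hre]; exact hκ) (by rw [hre]; exact hquarter)
      (by rw [hre, him]
          refine hzfr.trans (div_le_div_of_nonneg_left (by positivity) (Real.log_pos (by linarith)) ?_)
          exact Real.log_le_log (by linarith) (by linarith))
    have ht0 : 0 < |t| := lt_of_lt_of_le hη₀ ht
    refine hpt.trans (mul_le_mul_of_nonneg_left (add_le_add ?_ ?_) hK)
    · exact inv_anti₀ (pow_pos ht0 _) (pow_le_pow_left₀ (abs_nonneg t)
        (by rw [← him]; exact Complex.abs_im_le_norm s₂) _)
    · exact inv_anti₀ (pow_pos ht0 _) (pow_le_pow_left₀ (abs_nonneg t)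
        (by rw [← him]; exact Complex.abs_im_le_norm s₂) _)

/-- **The bump contribution**: with `X = η₀`, `4η ≤ θ ≤ η₀ ≤ 1`, `η ≤ 1`, `η + η₀ ≤ κ`,
`η + η₀ < 1/4`, `η + η₀ ≤ 4c̄/log(η₀ + η + 3)`:
`‖∫_θ^{η₀} r(x − iη₀)dx‖ + ‖∫_θ^{η₀} r(x + iη₀)dx‖ + ‖∫_{−η₀}^{η₀} r(η₀ + it)dt‖ ≤ 8 K_r η₀ / η₀^{q}`.
[cite: GoldstonPintzYildirim2009, Section 8 eq. 8.22] -/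
theorem norm_diagRes_bump_le
    (hWz : ∀ z : ℂ, z ≠ 0 → -(4 * cbar / Real.log (|z.im| + 3)) ≤ z.re →
      zetaOne z ≠ 0 ∧ ‖(zetaOne z)⁻¹‖ ≤ C * Real.log (|z.im| + 3) / ‖z‖ ∧
        ‖zetaOne z‖ ≤ 1 + C * ‖z‖ * Real.log (|z.im| + 3))
    (hc : 0 ≤ cbar) (hC : 0 ≤ C) {B κ ρW : ℝ} (hB0 : 0 ≤ B)
    (hGB : ∀ s₁ s₂ : ℂ, -κ ≤ s₁.re → s₁.re ≤ 2 → -κ ≤ s₂.re → s₂.re ≤ 2 → ‖G s₁ s₂‖ ≤ B)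
    (hρ : ∀ s : ℂ, ‖s‖ ≤ ρW → 1 / 2 ≤ ‖zetaOne s‖ ∧ ‖zetaOne s‖ ≤ 3 / 2)
    {R : ℝ} (hR : 1 ≤ R) (a b d u v : ℕ) {η θ η₀ : ℝ} (hη : 0 < η) (hη1 : η ≤ 1) (hηρ : 2 * η ≤ ρW)
    (hθ : 4 * η ≤ θ) (hθη₀ : θ ≤ η₀) (hη₀1 : η₀ ≤ 1) (hκ : η + η₀ ≤ κ) (hquarter : η + η₀ < 1 / 4)
    (hzfr : η + η₀ ≤ 4 * cbar / Real.log (η₀ + η + 3)) :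
    ‖∫ x : ℝ in θ..η₀, diagRes G R a b d u v η ((x : ℂ) + ((-η₀ : ℝ) : ℂ) * I)‖ +
      ‖∫ x : ℝ in θ..η₀, diagRes G R a b d u v η ((x : ℂ) + (η₀ : ℂ) * I)‖ +
      ‖∫ t : ℝ in (-η₀)..η₀, diagRes G R a b d u v η ((η₀ : ℂ) + t * I)‖ ≤
      8 * diagConst B C R η a b d u * (η₀ * (η₀ ^ ((u + 1 + a) + (v + 1 + b)))⁻¹) := by
  set K := diagConst B C R η a b d u with hKdef
  set q := (u + 1 + a) + (v + 1 + b) with hq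
  have hK := diagConst_nonneg hB0 (by linarith : (0:ℝ) ≤ R) hη.le a b d u (C := C)
  have hη₀ : 0 < η₀ := by linarith
  -- uniform bound `2K/η₀^q` at points with `θ ≤ Re s₂ ≤ η₀`, `|Im s₂| ≤ η₀`, `‖s₂‖ ≥ η₀`
  have hpt : ∀ s₂ : ℂ, θ ≤ s₂.re → s₂.re ≤ η₀ → |s₂.im| ≤ η₀ → η₀ ≤ ‖s₂‖ →
      ‖diagRes G R a b d u v η s₂‖ ≤ 2 * K * (η₀ ^ q)⁻¹ := by
    intro s₂ h1 h2 h3 h4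
    have h := norm_diagRes_le_unif hWz hc hC hB0 hGB hρ hR a b d u v (s₂ := s₂) hη hη1 hηρ
      (by linarith) (by linarith) (by linarith)
      (by refine le_trans (by linarith) (hzfr.trans (div_le_div_of_nonneg_left (by positivity)
            (Real.log_pos (by linarith [abs_nonneg s₂.im])) ?_))
          exact Real.log_le_log (by linarith [abs_nonneg s₂.im]) (by linarith))
    refine h.trans ?_
    have hn1 : ‖s₂‖ ≤ 2 := by
      have := Complex.norm_le_abs_re_add_abs_im s₂
      rw [abs_of_nonneg (by linarith : 0 ≤ s₂.re)] at this; linarith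
    have e1 : (‖s₂‖ ^ q)⁻¹ ≤ (η₀ ^ q)⁻¹ := inv_anti₀ (by positivity) (pow_le_pow_left₀ hη₀.le h4 _)
    have e2 : (‖s₂‖ ^ (u + v + 2))⁻¹ ≤ (η₀ ^ q)⁻¹ := by
      refine inv_anti₀ (by positivity) ?_
      calc η₀ ^ q ≤ η₀ ^ (u + v + 2) := pow_le_pow_of_le_one hη₀.le hη₀1 (by omega)
        _ ≤ ‖s₂‖ ^ (u + v + 2) := pow_le_pow_left₀ hη₀.le h4 _
    calc K * ((‖s₂‖ ^ q)⁻¹ + (‖s₂‖ ^ (u + v + 2))⁻¹) ≤ K * ((η₀ ^ q)⁻¹ + (η₀ ^ q)⁻¹) := by gcongr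
      _ = 2 * K * (η₀ ^ q)⁻¹ := by ring
  have hbot : ‖∫ x : ℝ in θ..η₀, diagRes G R a b d u v η ((x : ℂ) + ((-η₀ : ℝ) : ℂ) * I)‖ ≤
      (2 * K * (η₀ ^ q)⁻¹) * |η₀ - θ| := by
    refine intervalIntegral.norm_integral_le_of_norm_le_const fun x hx => ?_
    rw [uIoc_of_le hθη₀] at hx
    exact hpt _ (by simp; exact hx.1.le) (by simp; exact hx.2) (by simp [abs_of_pos hη₀])
      (by simpa [abs_of_pos hη₀] using Complex.abs_im_le_norm ((x : ℂ) + ((-η₀ : ℝ) : ℂ) * I))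
  have htop : ‖∫ x : ℝ in θ..η₀, diagRes G R a b d u v η ((x : ℂ) + (η₀ : ℂ) * I)‖ ≤
      (2 * K * (η₀ ^ q)⁻¹) * |η₀ - θ| := by
    refine intervalIntegral.norm_integral_le_of_norm_le_const fun x hx => ?_
    rw [uIoc_of_le hθη₀] at hx
    exact hpt _ (by simp; exact hx.1.le) (by simp; exact hx.2) (by simp [abs_of_pos hη₀])
      (by simpa [abs_of_pos hη₀] using Complex.abs_im_le_norm ((x : ℂ) + (η₀ : ℂ) * I))
  have hright : ‖∫ t : ℝ in (-η₀)..η₀, diagRes G R a b d u v η ((η₀ : ℂ) + t * I)‖ ≤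
      (2 * K * (η₀ ^ q)⁻¹) * |η₀ - -η₀| := by
    refine intervalIntegral.norm_integral_le_of_norm_le_const fun t ht => ?_
    rw [uIoc_of_le (by linarith)] at ht
    exact hpt _ (by simp; exact hθη₀) (by simp) (by simp; exact abs_le.2 ⟨ht.1.le, ht.2⟩)
      (by simpa [abs_of_pos hη₀] using Complex.abs_re_le_norm ((η₀ : ℂ) + t * I))
  rw [abs_of_nonneg (by linarith : 0 ≤ η₀ - θ)] at hbot htop
  rw [show η₀ - -η₀ = 2 * η₀ by ring, abs_of_pos (by linarith)] at hright
  have hθ0 : 0 ≤ θ := by linarith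
  have hKq : 0 ≤ 2 * K * (η₀ ^ q)⁻¹ := by positivity
  calc _ ≤ (2 * K * (η₀ ^ q)⁻¹) * (η₀ - θ) + (2 * K * (η₀ ^ q)⁻¹) * (η₀ - θ) +
        (2 * K * (η₀ ^ q)⁻¹) * (2 * η₀) := add_le_add (add_le_add hbot htop) hright
    _ ≤ (2 * K * (η₀ ^ q)⁻¹) * η₀ + (2 * K * (η₀ ^ q)⁻¹) * η₀ + (2 * K * (η₀ ^ q)⁻¹) * (2 * η₀) := by
        gcongr <;> linarith
    _ = 8 * K * (η₀ * (η₀ ^ q)⁻¹) := by ring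

end Diag

end Literature.NumberTheory.Sieve.GPY
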